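import Summits.CriticalPhenomena.PercolationContinuityZ3.Theorems.FK.PressureBetaDerivative
import HarnessLib

/-!
# LEBOWITZ'S THEOREM 3 IN ITS PRINTED FORM — WHERE `Ψ(β,0)` IS DIFFERENTIABLE IN `β`, THE TRANSLATION INVARIANT GIBBS
# STATES ARE THE MIXTURES OF `μ⁺` AND `μ⁻` — AND BODINEAU'S THEOREM REDUCED TO THE `β`-DIFFERENTIABILITY OF THE PRESSURE
# (Lebowitz 1977, §3, Thms. 2–3, Remarks (i), (iii); Bodineau 2006, §2.3)

Claimed R42 (8)(c) in the cell INBOX at 2026-08-29T00:59:05Z by fkp-10a gen 357 (NEW CLAIM #1 of the gen), addressed to coordinator fk-4 (next seated gen; gen 284 CLOSED l.8632; (ι) in force for windows); lineage row FO-10a-g357 (self-suggested), package g357-energy, label EB-D.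
Helper file of the `fk-continuity` build cell (bschramm lane; `--supports stmt-CriticalPhenomena-4575`); builds on
p205010 (kernel theorem, internal audit signed; external expert review pending). No definitions, no named facts
introduced (the tree's named fact `bodineau_translationInvariant` only appears as a CONCLUSION), no sorries; standard
axioms. UNCONDITIONAL (nearest-neighbour Ising model on `ℤ^d` at zero field).

`PressureBetaDerivative` identified `∂^±ψ/∂β (β,0)` with the plus / free nearest-neighbour energies and proved
Lebowitz's Thm. 2: `ψ(·,0)` is differentiable at `β > 0` iff `⟨σ_0σ_{eᵢ}⟩^∅_β = ⟨σ_0σ_{eᵢ}⟩⁺_β` for all `i`. The tree's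
`LebowitzCoexistence` (Thm. 3 from that identity) then gives, in the language of the derivative (the sufficient
condition "`m*` left-continuous at `β`" for the identity is the tree's `LebowitzMagnetizationCriterion`, Lebowitz's
Remark (iii) / Friedli–Velenik note [11] to p. 335, not re-derived here):

* **`translationInvariant_eq_mixture_of_differentiableAt`** — **LEBOWITZ 1977, THM. 3, PRINTED FORM**: for `d ≥ 2` and
  `β > β_c(d)` at which `ψ(·,0)` is differentiable in `β`, every translation invariant `μ ∈ 𝒢(β,0)` is
  `t μ⁺ + (1 − t) μ⁻`, `t ∈ [0,1]`; with `countable_not_differentiableAt_pressure_beta` this is his "with the possible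
  exception of a countable number of values of `β`";
* **`bodineau_translationInvariant_of_differentiableAt`** — the tree's NAMED FACT `bodineau_translationInvariant`
  (Bodineau 2006: for `d ≥ 3`, `β > β_c`, the translation invariant states are mixtures of `μ^±`) HOLDS AT EVERY `(d,β)`
  WHERE `ψ(·,0)` IS DIFFERENTIABLE IN `β` — so Bodineau's theorem is reduced to the `β`-differentiability of the
  zero-field pressure on `(β_c, ∞)` (equivalently, by `differentiableAt_pressure_beta_iff_forall`, to
  `⟨σ_0σ_{eᵢ}⟩^∅_β = ⟨σ_0σ_{eᵢ}⟩⁺_β`);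
* `sum_spinCorr_nn_mem_Icc` — the energies of all translation invariant Gibbs states at `β > 0` lie in the interval
  `[Σᵢ ⟨σ_0σ_{eᵢ}⟩^∅_β, Σᵢ ⟨σ_0σ_{eᵢ}⟩⁺_β] = [∂⁻ψ/∂β, ∂⁺ψ/∂β]`, which is a point iff `ψ(·,0)` is differentiable at `β`
  (`sum_plusCorr_nn_sub_sum_freeCorr_nn_eq_zero_iff`).

## References

* J. L. Lebowitz, *Coexistence of phases in Ising ferromagnets*, J. Stat. Phys. 16 (1977) 463–476, §3, Thms. 2–3,
  Remarks (i), (iii), pp. 470–472. [Lebowitz1977]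
* T. Bodineau, *Translation invariant Gibbs states for the Ising model*, Probab. Theory Related Fields 135 (2006)
  153–168, Thm. 2.1 and §2.3. [Bodineau2006]
* S. Friedli, Y. Velenik, *Statistical Mechanics of Lattice Systems*, CUP (2017), §3.10.8 and note [11] to p. 335.
  [FriedliVelenik2017]
* H.-O. Georgii, *Gibbs Measures and Phase Transitions*, 2nd ed., de Gruyter (2011), §18 Notes. [Georgii2011]
-/

noncomputable section

namespace Summit.CriticalPhenomena.PercolationContinuityZ3.Theorems.FK

namespace IsingEnergyDensity

open MeasureTheory Filter Topology Finset Set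
open scoped ENNReal
open Literature.Probability.LatticeModels
open Summit.CriticalPhenomena.PercolationContinuityZ3.Theorems.FK.ConcaveLimit

variable {d : ℕ}

/-! ### The energies of the translation invariant states fill `[∂⁻ψ/∂β, ∂⁺ψ/∂β]` -/

/-- **The nearest-neighbour energy of every translation invariant Gibbs state at `β > 0` lies in
`[Σᵢ ⟨σ_0σ_{eᵢ}⟩^∅_β, Σᵢ ⟨σ_0σ_{eᵢ}⟩⁺_β] = [∂⁻ψ/∂β (β,0), ∂⁺ψ/∂β (β,0)]`.** [cite: Lebowitz1977, §3, proof of Thm. 2, p. 470] -/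
theorem sum_spinCorr_nn_mem_Icc {β : ℝ} (hβ : 0 < β) {μ : Measure (SpinConfig (Site d))}
    (hμG : μ ∈ isingGibbsMeasures d β 0) (hμT : IsTranslationInvariantMeasure μ) :
    ∑ i, spinCorr μ {0, Pi.single i 1} ∈
      Icc (∑ i, freeCorr d β 0 {0, Pi.single i 1}) (∑ i, plusCorr d β 0 {0, Pi.single i 1}) :=
  ⟨sum_freeCorr_nn_le_sum_spinCorr_nn_of_isTranslationInvariant hβ hμG hμT,
    sum_le_sum fun _ _ => spinCorr_le_plusCorr_of_isGibbsMeasure hβ.le le_rfl hμG _⟩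

/-- **The interval `[∂⁻ψ/∂β, ∂⁺ψ/∂β]` is a point iff `ψ(·,0)` is differentiable at `β`**: for `β > 0`,
`Σᵢ ⟨σ_0σ_{eᵢ}⟩⁺_β − Σᵢ ⟨σ_0σ_{eᵢ}⟩^∅_β = 0 ↔ DifferentiableAt ℝ ψ(·,0) β` (and the difference is always `≥ 0`,
`sum_freeCorr_nn_le_sum_plusCorr_nn`). [cite: Lebowitz1977, §3, Thm. 2, p. 470] -/
theorem sum_plusCorr_nn_sub_sum_freeCorr_nn_eq_zero_iff {β : ℝ} (hβ : 0 < β) :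
    ∑ i, plusCorr d β 0 {0, Pi.single i 1} - ∑ i, freeCorr d β 0 {0, Pi.single i 1} = 0 ↔
      DifferentiableAt ℝ (fun b => pressure d b 0) β := by
  rw [differentiableAt_pressure_beta_iff hβ, sub_eq_zero, eq_comm]

/-! ### Lebowitz 1977, Theorem 3, printed form; Bodineau's theorem from differentiability -/

/-- **LEBOWITZ 1977, THEOREM 3 (PRINTED FORM): WHERE `Ψ(β,0)` IS DIFFERENTIABLE IN `β`, THE TRANSLATION INVARIANT GIBBS
STATES ARE THE MIXTURES OF `μ⁺` AND `μ⁻`.** For the nearest-neighbour Ising model on `ℤ^d`, `d ≥ 2`, at zero field and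
`β > β_c(d)`: if `b ↦ ψ(b,0)` is differentiable at `β`, then every translation invariant `μ ∈ 𝒢(β,0)` is
`t μ⁺ + (1 − t) μ⁻` for some `t ∈ [0,1]`, where `μ^± ∈ 𝒢(β,0)` have the correlations `plusCorr d β 0`, `minusCorr d β 0`
(differentiability ⇒ `⟨σ_0σ_{eᵢ}⟩^∅_β = ⟨σ_0σ_{eᵢ}⟩⁺_β` ⇒ the tree's `translationInvariant_eq_mixture_of_nn_freeCorr_eq_plusCorr`;
`m*(β) > 0` by Peierls). [cite: Lebowitz1977, §3, Thm. 3 and Remark (iii), pp. 471–472] -/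
theorem translationInvariant_eq_mixture_of_differentiableAt (hd : 2 ≤ d) {β : ℝ} (hβc : criticalBeta d < β)
    (hdiff : DifferentiableAt ℝ (fun b => pressure d b 0) β)
    {μ : Measure (SpinConfig (Site d))} (hμG : μ ∈ isingGibbsMeasures d β 0)
    (hμT : IsTranslationInvariantMeasure μ) :
    ∃ μp μm : Measure (SpinConfig (Site d)),
      μp ∈ isingGibbsMeasures d β 0 ∧ μm ∈ isingGibbsMeasures d β 0 ∧
        (∀ A, spinCorr μp A = plusCorr d β 0 A) ∧ (∀ A, spinCorr μm A = minusCorr d β 0 A) ∧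
          ∃ t : ℝ≥0∞, t ≤ 1 ∧ μ = t • μp + (1 - t) • μm := by
  have hβ : 0 < β := (criticalBeta_pos_holds hd).trans hβc
  exact translationInvariant_eq_mixture_of_nn_freeCorr_eq_plusCorr hβ
    (spontaneousMagnetization_pos_of_criticalBeta_lt_holds hd hβc)
    ((differentiableAt_pressure_beta_iff_forall hβ).1 hdiff) hμG hμT

/-- **LEBOWITZ 1977, THEOREM 3 WITH REMARK (i), assembled**: for `d ≥ 2` there is a countable set `S` of inverse
temperatures (the kinks of `ψ(·,0)`) such that at every `β > β_c(d)`, `β ∉ S`, all translation invariant Gibbs states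
are mixtures of `μ⁺` and `μ⁻`. (The tree's `countable_setOf_not_translationInvariant_eq_mixture` obtains the same with
`S` the discontinuity set of the plus energy; here `S` is the — a priori smaller — non-differentiability set of the
pressure.) [cite: Lebowitz1977, §3, Thm. 3 and Remark (i), pp. 471–472] -/
theorem translationInvariant_eq_mixture_off_kinks (hd : 2 ≤ d) :
    ∀ β : ℝ, criticalBeta d < β → β ∉ {b : ℝ | 0 < b ∧ ¬ DifferentiableAt ℝ (fun b' => pressure d b' 0) b} →
      ∀ μ ∈ isingGibbsMeasures d β 0, IsTranslationInvariantMeasure μ →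
        ∃ μp μm : Measure (SpinConfig (Site d)),
          μp ∈ isingGibbsMeasures d β 0 ∧ μm ∈ isingGibbsMeasures d β 0 ∧
            (∀ A, spinCorr μp A = plusCorr d β 0 A) ∧ (∀ A, spinCorr μm A = minusCorr d β 0 A) ∧
              ∃ t : ℝ≥0∞, t ≤ 1 ∧ μ = t • μp + (1 - t) • μm := by
  intro β hβc hβS μ hμG hμT
  have hβ : 0 < β := (criticalBeta_pos_holds hd).trans hβc
  have hdiff : DifferentiableAt ℝ (fun b' => pressure d b' 0) β := by
    by_contra h
    exact hβS ⟨hβ, h⟩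
  exact translationInvariant_eq_mixture_of_differentiableAt hd hβc hdiff hμG hμT

/-- **BODINEAU'S THEOREM FROM THE `β`-DIFFERENTIABILITY OF THE PRESSURE**: the tree's named fact
`bodineau_translationInvariant` (for `d ≥ 3`, `β > β_c(d)`: every translation invariant `μ ∈ 𝒢(β,0)` is a mixture of
`μ⁺` and `μ⁻`) holds at `(d, β)` as soon as `b ↦ ψ(b,0)` is differentiable at `β`. (Bodineau 2006 proves the
continuity of `m*` on `(β_c, ∞)` for `d ≥ 3`, which gives this differentiability by the tree's
`nn_freeCorr_eq_plusCorr_of_leftContinuous_magnetization` (`LebowitzMagnetizationCriterion`); that continuity is the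
deep input not in the tree.)
[cite: Bodineau2006, Thm. 2.1 and §2.3; Lebowitz1977, §3, Thm. 3, p. 472] -/
theorem bodineau_translationInvariant_of_differentiableAt {β : ℝ} (hβ : 0 < β)
    (hdiff : DifferentiableAt ℝ (fun b => pressure d b 0) β) :
    bodineau_translationInvariant (d := d) (β := β) :=
  bodineau_translationInvariant_of_nn_freeCorr_eq_plusCorr ((differentiableAt_pressure_beta_iff_forall hβ).1 hdiff)

/-- **Conversely, phase coexistence beyond `μ^±` forces a kink**: for `d ≥ 2`, `β > β_c(d)`, if some translation
invariant `μ ∈ 𝒢(β,0)` is NOT a mixture of `μ⁺` and `μ⁻`, then `ψ(·,0)` is not differentiable at `β`: the free and plus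
energies differ, `∂⁻ψ/∂β (β,0) < ∂⁺ψ/∂β (β,0)` (a first-order transition in `β`).
[cite: Lebowitz1977, §3, Thm. 3 and Remarks (i), (iii), pp. 471–472] -/
theorem not_differentiableAt_of_not_mixture (hd : 2 ≤ d) {β : ℝ} (hβc : criticalBeta d < β)
    {μ : Measure (SpinConfig (Site d))} (hμG : μ ∈ isingGibbsMeasures d β 0)
    (hμT : IsTranslationInvariantMeasure μ)
    (hnot : ¬ ∃ μp μm : Measure (SpinConfig (Site d)),
      μp ∈ isingGibbsMeasures d β 0 ∧ μm ∈ isingGibbsMeasures d β 0 ∧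
        (∀ A, spinCorr μp A = plusCorr d β 0 A) ∧ (∀ A, spinCorr μm A = minusCorr d β 0 A) ∧
          ∃ t : ℝ≥0∞, t ≤ 1 ∧ μ = t • μp + (1 - t) • μm) :
    ¬ DifferentiableAt ℝ (fun b => pressure d b 0) β := fun hdiff =>
  hnot (translationInvariant_eq_mixture_of_differentiableAt hd hβc hdiff hμG hμT)

end IsingEnergyDensity

end Summit.CriticalPhenomena.PercolationContinuityZ3.Theorems.FK

end
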